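import Summits.QuantumFields.BalabanUV.Beta.SpineRecursiveParity
import Summits.QuantumFields.BalabanUV.Beta.GAN24.SecondOrderCarrierParity
import Summits.QuantumFields.BalabanUV.Beta.GAN24.WSlotParityJunction
import Summits.QuantumFields.BalabanUV.Beta.FP.PeriodisedBorderTables

/-!
# `BalabanUV.Beta.FP.SecondOrderTableEvenPart` — road «FP» for binder row D1, ROUTE T, RULING R-FP-80 (J-RISK-2′) AT THE LATTICE: **THE GRADED-EVEN PART
# `W♮ := ½(W + sgnK (trK W))` OF A SECOND-ORDER TABLE — same `hessKer` against a sgn-symmetric chart, anti-twin torus border BY CONSTRUCTION, and the v4 wrapper's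
# even blocks** (so the v4 wrapper is the v3 wrapper instantiated at `W♮` — NO re-issue of the (S3-3) chain)

WHY.  `PackedLawFullIndexGraded(∕Socket)` (this gen's INTENT-1∕2) made the door's second-order slot parity-blind at the TORUS.  At the LATTICE the G-an2-4 lane
ALREADY typed the parity calculus this needs — the row-parity involution `X ↦ X^P := sgnK (trK X)` and the halves `½•(X ± X^P)` (`GAN24/SecondOrderReadersParity`,
gan24-leaf-03 g65), THE ODD HALF OF THE (III′) RECORD's `W2SymOfK` IS ITS RESPONSE WORD (`GAN24/SecondOrderCarrierParity.oddHalf_W2SymOfK`,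
`GAN24/CombSecondOrderCarrierParity.oddHalf_WcombOf_an1` — Engine C's WNTWIN «MIXED» is this fact by value), and the D1 END's blindness to a parity-odd
table (`GAN24/WSlotParityBlind.hessKer_sub_of_parityOdd`, gan24-p1 g33, over an1's `KernelWardRelativeEnd.tadpole_eq_zero_of_parity`) — all BY NAME below,
nothing restated.  So the cheaper road to the v4 wrapper is at the lattice: feed the v3 wrapper `StepRecursionFeedNestedNamedB`
(p405971) the graded-even parts `WN♮ ∕ WF♮ ∕ WG♮` of the row's tables — its parity rows `hWXt ∕ hWXm` are then THEOREMS (§3), its content rows `hHX₂ ∕ hQX₂` read the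
DISPLAYED even blocks `½(Ŵ b̃ b̃′ + Ŵ b̃′ b̃)` ∕ `½(Ŵ (f a) b̃ − Ŵ b̃ (f a))` (§3), its decay letter `hWX : VertexFamily₂` survives (§1, under the swap symmetry the row's
`W2SymOfK` has by `W2SymOfK_swap`), and its conclusion `hessKer (A_X) (V_X) (W_X♮)` IS `hessKer (A_X) (V_X) (W_X)` (§2) for a spread sgn-symmetric chart — an2's
`KernelWardRelativeEnd.tadpole_eq_zero_of_parity` applied to the odd half `W♭ := ½(W − sgnK (trK W))` (`WardLocusParitySplit.parityOdd_oddHalf`).  §1 the halves'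
entries and the `Loc` letter of the even half (the algebra is the GAN24 lane's: `evenHalf_add_oddHalf ∕ parityEven_evenHalf ∕ parityOdd_oddHalf ∕ loc_oddHalf ∕ vertexFamily₂_evenHalf_of_swap` BY NAME);
§2 **`tadpole_evenHalf`**, **`hessKer_evenHalf`** (the `W ↦ W♮` form of `WSlotParityBlind`'s `± X` statements; pointwise and as functions, from `VertexFamily₂`); §3 the torus face (NEW):
`dper` commutes with `trK ∕ sgnK` (and with scalars: leaf-05's `PeriodisedBorderTables.dper_smul` BY NAME) and adds on bi-localised kernels (two-centre form of an2's `CombHId2Letters.dper_add_of_biLoc`), `perF M (sgnK K)` entrywise, **`perF_dper_evenHalf_apply`**: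
`perF M (dper M W♮) p q = ½(Ŵ p q + sgnF p.2·sgnF q.2·Ŵ q p)`, `Ŵ := perF M (dper M W)`; hence the blocks `_inl_inl`, **`_antitwin_fμ`** (the v3 row `hWXt` for `W♮`, ANY `W`),
`_mm` (the v3 row `hWXm` for `W♮` from `Ŵ|μμ = 0`), **`_submatrix_ff ∕ _submatrix_μf`** (the v4 rows' right sides).
[folklore] `tsum`∕parity bookkeeping BY NAME (E-FP-39-2∕40-2: the GAN24 lane's parity files searched and cited, three restatements of my first draft removed at the dry-run); no `def`, no `def … : Prop`, nothing cited, 0 sorry; 0 estimates.  NOT HERE: the v4 wrapper; `trK (AN R j) = sgnK (AN R j)`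
for the one-shot charts (Q-FP-40-1 to the row; `CombChartWardSockets.trK_GcombSh` is the coarse system's); whether the colour-stripped literal SHOULD carry a
graded-even response word ((T-ID)∕(P6), not adjudicated).

HONEST DEPENDENCY (page 1, mandatory): continuum YM on T⁴ ⇐ BetaPertH ∧ nine spine estimates (0/9 proved); BetaPertH ⇐ (D1) ∧ (D4) ∧ CAP+tail;
G-an2-4 gates asym, D1 and NE2/3/4.  HONEST FRAMING (cell contract, verbatim): «discharging `BetaPertH` makes Bałaban's UV stability UNCONDITIONAL —
a real constructive-QFT result; it is NOT the continuum limit and NOT the Clay problem.»  ABSOLUTE RULE (cell charter, verbatim): «No internally-minted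
statement may enter as a cited fact. Every hypothesis is either kernel-proved in this package or a verbatim quotation of a PUBLISHED theorem with page
reference. The manuscript(s) under audit are NOT citable for their own disputed steps — they are the thing under adjudication; programme-internal
(2001/route/tribunal) claims are never citable.»  Nothing of the dictionary's identification ∕ Bałaban's asserted; 0∕4 row-D1 binders (hW, hR, D1Tel, D1Rep);
NOT (T-ID), NOT SDF, NOT D1, NOT BetaPertH, NOT continuum, NOT Clay.  Road «FP» OWNER, b2b-balaban-beta-d1-p3 gen 40, 2026-08-27.  No existing file touched.
-/

noncomputable section

open scoped BigOperators Matrix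

namespace Summit.QuantumFields.BalabanUV.Beta.FP.SecondOrderTableEvenPart

open Literature.MathematicalPhysics.QuantumFieldTheory.Balaban1983to89
open Literature.MathematicalPhysics.QuantumFieldTheory.Balaban1983to89.Beta
open B4TorusKernel.MultiPeriod (translate)
open B6Lemma24Torus (pbox)
open B12Sec2to5 (l1)
open ExpKernelCalculus (MKer Decays BiLoc VertexFamily₂ tadpole bubble hessKer)
open HessKerRate (scaleK scaleK_apply)
open OneStepResolventKernel (Fib)
open Summit.QuantumFields.BalabanUV.Beta.TameKernelCalculus (Spr Loc trK trK_apply trK_trK trK_add trK_sub Loc.add Loc.sub Loc.smul Loc.trK decays_trK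
  biLoc_trK tadpole_add)
open Summit.QuantumFields.BalabanUV.Beta.BorderedHessian (sgnF sgnF_inl sgnF_inr sgnF_mul_self sgnK sgnK_apply sgnK_sgnK trK_sgnK decays_sgnK)
open Summit.QuantumFields.BalabanUV.Beta.BubbleParity (sgnK_neg)
open Summit.QuantumFields.BalabanUV.Beta.KernelWardRelativeEnd (tadpole_eq_zero_of_parity)
open Summit.QuantumFields.BalabanUV.Beta.KernelWardRemainderParity (sgnK_add)
open Summit.QuantumFields.BalabanUV.Beta.SpineRecursiveParity (sgnK_smul trK_smul loc_sgnK)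
open Summit.QuantumFields.BalabanUV.Beta.WardLocusParitySplit (parityOdd_oddHalf)
open Summit.QuantumFields.BalabanUV.Beta.GAN24.SecondOrderReadersParity (evenHalf_add_oddHalf parityEven_evenHalf evenHalf_eq_self_of_even)
open Summit.QuantumFields.BalabanUV.Beta.GAN24.SecondOrderCarrierParity (biLoc_sgnK_trK)
open Summit.QuantumFields.BalabanUV.Beta.GAN24.WSlotParityJunction (loc_oddHalf)
open Summit.QuantumFields.BalabanUV.Beta.FP.KernelPeriodisationFib (Idx perF perF_apply perZ_apply perF_transpose perF_scaleK_apply perF_add perF_smul)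
open Summit.QuantumFields.BalabanUV.Beta.FP.KernelPeriodisationFibLoc (dper dper_apply dper_translate summable_dper decays_dper)
open Summit.QuantumFields.BalabanUV.Beta.FP.PeriodisedBorderTables (dper_smul)

variable {d : ℕ}

/-! ## §1 The halves `W♮ := ½•(W + sgnK (trK W))`, `W♭ := ½•(W − sgnK (trK W))` (the GAN24 lane's involution calculus BY NAME): entries and `Loc` letters -/

section Parts

/-- [folklore] entries of the graded-even part: `W♮ x y a b = ½(W x y a b + sgnF a·sgnF b·W y x b a)`. -/
theorem evenHalf_apply (W : MKer (d + 1) (Fib d)) (x y : Fin (d + 1) → ℤ) (a b : Fib d) :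
    ((1 / 2 : ℝ) • (W + sgnK (trK W))) x y a b = (1 / 2 : ℝ) * (W x y a b + sgnF a * sgnF b * W y x b a) := by
  simp only [Pi.smul_apply, Pi.add_apply, smul_eq_mul, sgnK_apply, trK_apply]

/-- [folklore] entries of the graded-odd part: `W♭ x y a b = ½(W x y a b − sgnF a·sgnF b·W y x b a)`. -/
theorem oddHalf_apply (W : MKer (d + 1) (Fib d)) (x y : Fin (d + 1) → ℤ) (a b : Fib d) :
    ((1 / 2 : ℝ) • (W - sgnK (trK W))) x y a b = (1 / 2 : ℝ) * (W x y a b - sgnF a * sgnF b * W y x b a) := by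
  simp only [Pi.smul_apply, Pi.sub_apply, smul_eq_mul, sgnK_apply, trK_apply]

/-- [folklore] the graded-even part of a localised table is localised. -/
theorem loc_evenHalf {W : MKer (d + 1) (Fib d)} (h : Loc W) : Loc ((1 / 2 : ℝ) • (W + sgnK (trK W))) :=
  Loc.smul _ (Loc.add h (loc_sgnK (Loc.trK h)))

/-- [folklore] a bi-localised kernel is localised (the class `Loc`). -/
theorem loc_of_biLoc {W : MKer (d + 1) (Fib d)} {p q : Fin (d + 1) → ℤ} {C δ : ℝ} (h : BiLoc W p q C δ) (hδ : 0 < δ) : Loc W :=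
  ⟨p, q, C, δ, hδ, h⟩

end Parts

/-! ## §2 The graded-odd part is dead weight in `hessKer` against a spread sgn-symmetric chart -/

section Tadpole

/-- [folklore] **`tadpole_evenHalf` — THE TADPOLE SEES ONLY THE GRADED-EVEN PART**: for a spread sgn-symmetric `A` (`trK A = sgnK A`) and a localised `W`,
`tadpole A W♮ = tadpole A W` (`W = W♮ + W♭`, `tadpole_add`, an1's `tadpole_eq_zero_of_parity` on the parity-odd `W♭`; the `± X` family form is gan24-p1's `WSlotParityBlind.tadpole_sub_of_parityOdd`). -/
theorem tadpole_evenHalf {A W : MKer (d + 1) (Fib d)} (hA : Spr A) (hAt : trK A = sgnK A) (hW : Loc W) :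
    tadpole A ((1 / 2 : ℝ) • (W + sgnK (trK W))) = tadpole A W := by
  have h0 : tadpole A ((1 / 2 : ℝ) • (W - sgnK (trK W))) = 0 := tadpole_eq_zero_of_parity hA hAt (loc_oddHalf hW) (parityOdd_oddHalf W)
  conv_rhs => rw [← evenHalf_add_oddHalf W, tadpole_add hA (loc_evenHalf hW) (loc_oddHalf hW), h0, add_zero]

/-- [folklore] **`hessKer_evenHalf_apply`**: the resolvent Hessian kernel at `(μ, ν, z)` is unchanged when the second-order table is replaced by its graded-even part
(`hessKer = ½·tadpole − ½·bubble`; the bubble does not see `W`). -/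
theorem hessKer_evenHalf_apply {A : MKer (d + 1) (Fib d)} (hA : Spr A) (hAt : trK A = sgnK A) (V : Fin (d + 1) → (Fin (d + 1) → ℤ) → MKer (d + 1) (Fib d))
    {W : Fin (d + 1) → (Fin (d + 1) → ℤ) → Fin (d + 1) → (Fin (d + 1) → ℤ) → MKer (d + 1) (Fib d)} (μ ν : Fin (d + 1)) (z : Fin (d + 1) → ℤ)
    (hW : Loc (W μ 0 ν z)) :
    hessKer A V (fun μ y ν y' => (1 / 2 : ℝ) • (W μ y ν y' + sgnK (trK (W μ y ν y')))) μ ν z = hessKer A V W μ ν z := by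
  unfold ExpKernelCalculus.hessKer
  rw [tadpole_evenHalf hA hAt hW]

/-- [folklore] **`hessKer_evenHalf`** — as functions, from a `VertexFamily₂` letter (every member bi-localised, hence localised). -/
theorem hessKer_evenHalf {A : MKer (d + 1) (Fib d)} (hA : Spr A) (hAt : trK A = sgnK A) (V : Fin (d + 1) → (Fin (d + 1) → ℤ) → MKer (d + 1) (Fib d))
    {W : Fin (d + 1) → (Fin (d + 1) → ℤ) → Fin (d + 1) → (Fin (d + 1) → ℤ) → MKer (d + 1) (Fib d)} {N : ℕ} {C δ : ℝ} (hW : VertexFamily₂ W N C δ) (hδ : 0 < δ) :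
    hessKer A V (fun μ y ν y' => (1 / 2 : ℝ) • (W μ y ν y' + sgnK (trK (W μ y ν y')))) = hessKer A V W := by
  funext μ ν z
  exact hessKer_evenHalf_apply hA hAt V μ ν z (loc_of_biLoc (hW μ 0 ν z) hδ)

end Tadpole

/-! ## §3 The torus face: `perF M (dper M W♮)` entrywise, its anti-twin border, its even blocks -/

section Torus

variable (M : Fin (d + 1) → ℕ)

/-- [folklore] `dper` commutes with transposition (re-indexing only). -/
theorem dper_trK (V : MKer (d + 1) (Fib d)) : dper M (trK V) = trK (dper M V) := by
  funext x y a b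
  simp only [dper_apply, trK_apply]

/-- [folklore] `dper` commutes with the sign conjugation (`tsum_mul_left`). -/
theorem dper_sgnK (V : MKer (d + 1) (Fib d)) : dper M (sgnK V) = sgnK (dper M V) := by
  funext x y a b
  simp only [dper_apply, sgnK_apply]
  rw [tsum_mul_left]

variable [∀ i, NeZero (M i)]

/-- [folklore] `dper` adds on bi-localised kernels (`Summable.tsum_add` with `summable_dper`). -/
theorem dper_add_of_biLoc₂ {V V' : MKer (d + 1) (Fib d)} {p q p' q' : Fin (d + 1) → ℤ} {C δ C' δ' : ℝ} (hV : BiLoc V p q C δ) (hC : 0 ≤ C) (hδ : 0 < δ)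
    (hV' : BiLoc V' p' q' C' δ') (hC' : 0 ≤ C') (hδ' : 0 < δ') : dper M (V + V') = dper M V + dper M V' := by
  funext x y a b
  simp only [dper_apply, Pi.add_apply]
  exact (summable_dper M hV hC hδ x y a b).tsum_add (summable_dper M hV' hC' hδ' x y a b)

/-- [folklore] **`dper_evenHalf`**: `dper M W♮ = ½•(dper M W + sgnK (trK (dper M W)))` for a bi-localised `W`. -/
theorem dper_evenHalf {W : MKer (d + 1) (Fib d)} {p q : Fin (d + 1) → ℤ} {C δ : ℝ} (hW : BiLoc W p q C δ) (hC : 0 ≤ C) (hδ : 0 < δ) :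
    dper M ((1 / 2 : ℝ) • (W + sgnK (trK W))) = (1 / 2 : ℝ) • (dper M W + sgnK (trK (dper M W))) := by
  rw [dper_smul, dper_add_of_biLoc₂ M hW hC hδ (biLoc_sgnK_trK hW) hC hδ, dper_sgnK, dper_trK]

omit [∀ i, NeZero (M i)] in
/-- [folklore] `perF M (sgnK K) p q = sgnF p.2 · sgnF q.2 · perF M K p q` (`sgnK = scaleK sgnF sgnF`; `perF_scaleK_apply`). -/
theorem perF_sgnK_apply (K : MKer (d + 1) (Fib d)) (p q : Idx M (Fib d)) :
    perF M (sgnK K) p q = sgnF p.2 * sgnF q.2 * perF M K p q := by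
  have h : sgnK K = scaleK sgnF sgnF K := by
    funext x y a b; rw [sgnK_apply, scaleK_apply]; ring
  rw [h, perF_scaleK_apply]; ring

omit [∀ i, NeZero (M i)] in
/-- [folklore] `perF M (trK K) p q = perF M K q p` for an `M`-invariant kernel (`KernelPeriodisationFib.perF_transpose`; `trK = trF` definitionally). -/
theorem perF_trK_apply {K : MKer (d + 1) (Fib d)}
    (hK : ∀ (m x y : Fin (d + 1) → ℤ) (a b : Fib d), K (translate M x m) (translate M y m) a b = K x y a b) (p q : Idx M (Fib d)) :
    perF M (trK K) p q = perF M K q p := by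
  have h := congrFun (congrFun (perF_transpose M hK) p) q
  rw [Matrix.transpose_apply] at h
  exact h

/-- [folklore] **`perF_dper_evenHalf_apply` — THE TORUS FACE OF THE GRADED-EVEN PART**: for a bi-localised `W`, with `Ŵ := perF M (dper M W)`,
`perF M (dper M W♮) p q = ½(Ŵ p q + sgnF p.2·sgnF q.2·Ŵ q p)` (`dper_evenHalf`; `perF_smul ∕ perF_add` on the decaying `dper M W`; `perF_sgnK_apply`;
`KernelPeriodisationFib.perF_transpose` at the `M`-invariant `dper M W`). -/
theorem perF_dper_evenHalf_apply {W : MKer (d + 1) (Fib d)} {p₀ q₀ : Fin (d + 1) → ℤ} {C δ : ℝ} (hW : BiLoc W p₀ q₀ C δ) (hC : 0 ≤ C) (hδ : 0 < δ)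
    (p q : Idx M (Fib d)) :
    perF M (dper M ((1 / 2 : ℝ) • (W + sgnK (trK W)))) p q
      = (1 / 2 : ℝ) * (perF M (dper M W) p q + sgnF p.2 * sgnF q.2 * perF M (dper M W) q p) := by
  have hD := decays_dper M hW hC hδ
  have hD' : Decays (sgnK (trK (dper M W))) _ _ := decays_sgnK (decays_trK hD)
  have hδ2 : 0 < δ / 2 := by positivity
  rw [dper_evenHalf M hW hC hδ, perF_smul, perF_add M hD hD' hδ2 hδ2, Matrix.smul_apply, Matrix.add_apply, perF_sgnK_apply,
    perF_trK_apply M (fun m x y a b => dper_translate M W m x y a b), smul_eq_mul]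

variable {μ : Type*} (fμ : μ → Idx M (Fib d))

/-- [folklore] the `ff` entries of the even table: `Ŵ♮ (x, inl α) (y, inl β) = ½(Ŵ (x, inl α) (y, inl β) + Ŵ (y, inl β) (x, inl α))`. -/
theorem perF_dper_evenHalf_inl_inl {W : MKer (d + 1) (Fib d)} {p₀ q₀ : Fin (d + 1) → ℤ} {C δ : ℝ} (hW : BiLoc W p₀ q₀ C δ) (hC : 0 ≤ C) (hδ : 0 < δ)
    (x y : ↥(pbox M)) (α β : Fin (d + 1)) :
    perF M (dper M ((1 / 2 : ℝ) • (W + sgnK (trK W)))) (x, Sum.inl α) (y, Sum.inl β)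
      = (1 / 2 : ℝ) * (perF M (dper M W) (x, Sum.inl α) (y, Sum.inl β) + perF M (dper M W) (y, Sum.inl β) (x, Sum.inl α)) := by
  rw [perF_dper_evenHalf_apply M hW hC hδ, sgnF_inl, sgnF_inl, one_mul, one_mul]

/-- [folklore] **`perF_dper_evenHalf_antitwin_fμ` — THE v3 ROW `hWXt` IS A THEOREM FOR THE EVEN TABLE, ANY `W`**: along a multiplier-valued packing injection,
`Ŵ♮ (b̃, fμ a) = −Ŵ♮ (fμ a, b̃)`. -/
theorem perF_dper_evenHalf_antitwin_fμ (hμ : ∀ a : μ, ∃ m : Fin (d + 1), (fμ a).2 = Sum.inr m)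
    {W : MKer (d + 1) (Fib d)} {p₀ q₀ : Fin (d + 1) → ℤ} {C δ : ℝ} (hW : BiLoc W p₀ q₀ C δ) (hC : 0 ≤ C) (hδ : 0 < δ)
    (b : ↥(pbox M) × Fin (d + 1)) (a : μ) :
    perF M (dper M ((1 / 2 : ℝ) • (W + sgnK (trK W)))) (b.1, Sum.inl b.2) (fμ a)
      = -perF M (dper M ((1 / 2 : ℝ) • (W + sgnK (trK W)))) (fμ a) (b.1, Sum.inl b.2) := by
  obtain ⟨m, hm⟩ := hμ a
  rw [perF_dper_evenHalf_apply M hW hC hδ, perF_dper_evenHalf_apply M hW hC hδ, hm, sgnF_inl, sgnF_inr]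
  ring

/-- [folklore] **`perF_dper_evenHalf_mm` — THE v3 ROW `hWXm` PASSES TO THE EVEN TABLE**: if `Ŵ|μμ = 0` on `range fμ` then `Ŵ♮|μμ = 0` there. -/
theorem perF_dper_evenHalf_mm {W : MKer (d + 1) (Fib d)} {p₀ q₀ : Fin (d + 1) → ℤ} {C δ : ℝ} (hW : BiLoc W p₀ q₀ C δ) (hC : 0 ≤ C) (hδ : 0 < δ)
    (hmm : ∀ a a' : μ, perF M (dper M W) (fμ a) (fμ a') = 0) (a a' : μ) :
    perF M (dper M ((1 / 2 : ℝ) • (W + sgnK (trK W)))) (fμ a) (fμ a') = 0 := by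
  rw [perF_dper_evenHalf_apply M hW hC hδ, hmm, hmm, mul_zero, add_zero, mul_zero]

/-- [folklore] **`perF_dper_evenHalf_submatrix_ff` — THE v4 ROW `hHX₂`'s RIGHT SIDE**: `Ŵ♮.sub e_F e_F = Matrix.of (b b′ ↦ ½(Ŵ b̃ b̃′ + Ŵ b̃′ b̃))`. -/
theorem perF_dper_evenHalf_submatrix_ff {W : MKer (d + 1) (Fib d)} {p₀ q₀ : Fin (d + 1) → ℤ} {C δ : ℝ} (hW : BiLoc W p₀ q₀ C δ) (hC : 0 ≤ C) (hδ : 0 < δ) :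
    (perF M (dper M ((1 / 2 : ℝ) • (W + sgnK (trK W))))).submatrix
        (fun b : ↥(pbox M) × Fin (d + 1) => ((b.1, Sum.inl b.2) : Idx M (Fib d)))
        (fun b : ↥(pbox M) × Fin (d + 1) => ((b.1, Sum.inl b.2) : Idx M (Fib d)))
      = Matrix.of fun b b' : ↥(pbox M) × Fin (d + 1) =>
          (1 / 2 : ℝ) * (perF M (dper M W) (b.1, Sum.inl b.2) (b'.1, Sum.inl b'.2) + perF M (dper M W) (b'.1, Sum.inl b'.2) (b.1, Sum.inl b.2)) := by
  ext b b'
  rw [Matrix.submatrix_apply, Matrix.of_apply, perF_dper_evenHalf_inl_inl M hW hC hδ]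

/-- [folklore] **`perF_dper_evenHalf_submatrix_μf` — THE v4 ROW `hQX₂`'s RIGHT SIDE**: along a multiplier-valued packing injection,
`Ŵ♮.sub fμ e_F = Matrix.of (a b ↦ ½(Ŵ (fμ a) b̃ − Ŵ b̃ (fμ a)))`. -/
theorem perF_dper_evenHalf_submatrix_μf (hμ : ∀ a : μ, ∃ m : Fin (d + 1), (fμ a).2 = Sum.inr m)
    {W : MKer (d + 1) (Fib d)} {p₀ q₀ : Fin (d + 1) → ℤ} {C δ : ℝ} (hW : BiLoc W p₀ q₀ C δ) (hC : 0 ≤ C) (hδ : 0 < δ) :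
    (perF M (dper M ((1 / 2 : ℝ) • (W + sgnK (trK W))))).submatrix fμ
        (fun b : ↥(pbox M) × Fin (d + 1) => ((b.1, Sum.inl b.2) : Idx M (Fib d)))
      = Matrix.of fun (a : μ) (b : ↥(pbox M) × Fin (d + 1)) =>
          (1 / 2 : ℝ) * (perF M (dper M W) (fμ a) (b.1, Sum.inl b.2) - perF M (dper M W) (b.1, Sum.inl b.2) (fμ a)) := by
  ext a b
  obtain ⟨m, hm⟩ := hμ a
  rw [Matrix.submatrix_apply, Matrix.of_apply, perF_dper_evenHalf_apply M hW hC hδ, hm, sgnF_inr, sgnF_inl]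
  ring

end Torus

end Summit.QuantumFields.BalabanUV.Beta.FP.SecondOrderTableEvenPart

end
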